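import Mathlib
import HarnessLib
import Summits.QuantumFields.YangMills.Theses.ScalingWindowSplit
import Summits.QuantumFields.YangMills.Theorems.LangevinControlUVOSLegsFromFemtoAndGapStubUpgrade

/-!
# Route `ScalingWindowSplit`, support item `EuclideanUpgrade` (stmt-QuantumFields-18949)

The route item `Summit.QuantumFields.YangMills.Theses.ScalingWindowSplit.EuclideanUpgrade` is shared
verbatim with the parent route's `CoincidenceRotationBootstrap.EuclideanUpgrade` (stmt-QuantumFields-8647,
DENSITY UPGRADE: for any label type `ι` and any labelled Schwinger family `S` on `ℝ⁴`, invariance on `⁰𝒮`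
under every proper hypercubic isometry and under the `Σ5` rotation of the `(x₂,x₃)`-plane implies
invariance on `⁰𝒮` under every determinant-one linear isometry), which is already proved in the tree as
`Summit.QuantumFields.YangMills.Cruxes.OSLegsFromFemtoAndGap.DlrCollarTransfer.stub_upgrade`
(`Theorems/LangevinControlUVOSLegsFromFemtoAndGapStubUpgrade.lean`; group theory: closed subgroups of `ℝ`,
Niven's theorem, Givens generation of `SO(4)`).

The two route definitions are syntactically identical, hence definitionally equal; this file transfers
the landed proof. It exists only so that the route file `Theses/ScalingWindowSplit.lean` need not import
the (heavier) Theorems module of the landed proof (cone repair rev 4 of the route).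

References: Osterwalder–Schrader 1973 §2 (axiom E1); I. Niven, *Irrational Numbers* (1956), Cor. 3.12.
No definitions, no notation.
-/

namespace Summit.QuantumFields.YangMills.Theorems.ScalingWindowSplit

/-- **Support item `EuclideanUpgrade`** of route `ScalingWindowSplit` (stmt-QuantumFields-18949):
proper-hypercubic + `Σ5` invariance of a labelled Schwinger family on `⁰𝒮(ℝ⁴)` implies invariance under
every determinant-one linear isometry of `ℝ⁴`. Proof: the statement is definitionally the parent route's
`CoincidenceRotationBootstrap.EuclideanUpgrade`, proved as `DlrCollarTransfer.stub_upgrade`.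
[cite: Niven1956, Cor. 3.12] -/
theorem euclideanUpgrade_proof :
    Summit.QuantumFields.YangMills.Theses.ScalingWindowSplit.EuclideanUpgrade := by
  unfold Summit.QuantumFields.YangMills.Theses.ScalingWindowSplit.EuclideanUpgrade
  exact Summit.QuantumFields.YangMills.Cruxes.OSLegsFromFemtoAndGap.DlrCollarTransfer.stub_upgrade

end Summit.QuantumFields.YangMills.Theorems.ScalingWindowSplit
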